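import Summits.NavierStokesRegularity.NavierStokesRegularity.Theorems.AxisymmetricExtremalityAxisymmetricKatoGlobalStubSeregin2020TypeIILemma22InvCylRadius
import HarnessLib

/-!
# Seregin 2020, Lemma 2.2 (after Nazarov–Uraltseva 2012): the two drift integrals of the energy
# method — `∫∫ |u|` from the `L_{3,4}` bound and `∫∫ 1/|x'|` — on sub-cylinders of the slab

Helper toward the stub `stub_seregin2020TypeII` of the crux `AxisymmetricKatoGlobal` (= the named
fact `Literature.Analysis.FluidPDE.Seregin2020_axisymmetricSingularPoint_typeII`, Seregin 2020,
Thm 2.1), reduced in the tree to the written-out hypothesis `hWH′` (= N–U 2012 Lemma 4.2 for the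
class 𝒱). In every energy estimate of N–U §3 (Lemmata 3.1–3.3) the drift `b = u + 2x'/|x'|²`
enters through `∫∫ |b| (V-k)₋² ζ|Dζ|`, i.e. — after `(V-k)₋² ≤ k²`-type bounds — through the two
integrals `∫∫_W |u|` and `∫∫_W 1/|x'|` over a sub-cylinder `W` of the slab
`]-R², 0[ × B(2R)` on which the standing hypotheses give
`∫_{-R²}^0 (∫_{B(2R)} |u|³)^{4/3} ≤ N R²` (`q = 3`, `ℓ = 4`, `α = 1/2`; N–U Remark 5). This file
bounds them scale-invariantly:

* `lintegral_enorm_drift_le` — `∫∫_W |u| ≤ (N R²)^{1/4} (R²)^{1/12} |W|^{2/3}` (Tonelli, Hölder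
  `(4/3, 4)` in time, Hölder `(3, 3/2)` on `W`);
* `lintegral_inv_cylRadius_Ico_closedBall_le` — `∫∫_{[a,t₀[ × B̄(ρ₁)} 1/|x'| ≤ C₁ (t₀-a) (2ρ₁)²`
  with the constant of `lintegral_inv_cylRadius_rpow_ball_le` (`q = 1`).

## References

* A. I. Nazarov, N. N. Uraltseva, St. Petersburg Math. J. 23 (2012) 93–115 = arXiv:1011.1888,
  §3 (3.3), proofs of Lemmata 3.2–3.3 (the drift terms), Remark 5; §4 (the drift `2x'/|x'|²`).
  [NazarovUraltseva2012]
* G. Seregin, Anal. Math. Phys. 10 (2020), Paper 46 = arXiv:2006.04140, Lemma 2.2, (2.10).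
  [Seregin2020]
-/

-- the problem directory repeats the summit name (D-0017); core's `dupNamespace` linter fires
set_option linter.dupNamespace false

noncomputable section

open MeasureTheory Set Function Filter Topology Metric Module
open scoped NNReal ENNReal

namespace Summit.NavierStokesRegularity.NavierStokesRegularity.Theorems.AxisymmetricKatoGlobal.EulerScaling

open Literature.Analysis.FluidPDE

/-- **The drift integral `∫∫_W |u|` from the `L_{3,4}` bound.** If `u` is a.e.-strongly
measurable on the slab `]-R², 0[ × B(2R)` with `∫_{-R²}^0 (∫_{B(2R)} |u|³)^{4/3} ≤ N R²`, then for
every `W` inside the slab, `∫∫_W |u| ≤ (N R²)^{1/4} (R²)^{1/12} |W|^{2/3}`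
(`∫∫_{slab} |u|³ ≤ (N R²)^{3/4} (R²)^{1/4}` by Tonelli and Hölder in time, then Hölder on `W`).
[cite: NazarovUraltseva2012, §3 (3.3) and Remark 5; Seregin2020, (2.10)] -/
theorem lintegral_enorm_drift_le
    {U : ℝ → EuclideanSpace ℝ (Fin 3) → EuclideanSpace ℝ (Fin 3)} {R : ℝ} {N : ℝ≥0}
    (hU : AEStronglyMeasurable (uncurry U)
      (volume.restrict (Ioo (-R ^ 2) 0 ×ˢ ball (0 : EuclideanSpace ℝ (Fin 3)) (2 * R))))
    (hdrift : ∫⁻ s in Ioo (-R ^ 2) 0, (∫⁻ y in ball (0 : EuclideanSpace ℝ (Fin 3)) (2 * R),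
      ‖U s y‖ₑ ^ (3 : ℕ)) ^ (4 / 3 : ℝ) ≤ (N : ℝ≥0∞) * ENNReal.ofReal R ^ 2)
    {W : Set (ℝ × EuclideanSpace ℝ (Fin 3))}
    (hW : W ⊆ Ioo (-R ^ 2) 0 ×ˢ ball (0 : EuclideanSpace ℝ (Fin 3)) (2 * R)) :
    ∫⁻ z in W, ‖U z.1 z.2‖ₑ ≤
      ((N : ℝ≥0∞) * ENNReal.ofReal R ^ 2) ^ (1 / 4 : ℝ) * ENNReal.ofReal (R ^ 2) ^ (1 / 12 : ℝ) *
        volume W ^ (2 / 3 : ℝ) := by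
  set I : Set ℝ := Ioo (-R ^ 2) 0 with hI
  set B : Set (EuclideanSpace ℝ (Fin 3)) := ball (0 : EuclideanSpace ℝ (Fin 3)) (2 * R) with hB
  have hprod : (volume.restrict (I ×ˢ B) : Measure (ℝ × EuclideanSpace ℝ (Fin 3))) =
      (volume.restrict I).prod (volume.restrict B) := by
    rw [Measure.volume_eq_prod, Measure.prod_restrict]
  -- a.e.-measurability of `|u|³` on the slab and of `|u|` on `W`
  have h3m : AEMeasurable (fun z : ℝ × EuclideanSpace ℝ (Fin 3) => ‖U z.1 z.2‖ₑ ^ (3 : ℕ))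
      ((volume.restrict I).prod (volume.restrict B)) := by
    rw [← hprod]; exact hU.enorm.pow_const _
  have h1m : AEMeasurable (fun z : ℝ × EuclideanSpace ℝ (Fin 3) => ‖U z.1 z.2‖ₑ)
      (volume.restrict W) :=
    (hU.mono_measure (Measure.restrict_mono hW le_rfl)).enorm
  -- ### `∫∫_{slab} |u|³ ≤ (N R²)^{3/4} (R²)^{1/4}`
  have hIvol : volume I = ENNReal.ofReal (R ^ 2) := by
    rw [hI, Real.volume_Ioo]; congr 1; ring
  have hJ : ∫⁻ z in I ×ˢ B, ‖U z.1 z.2‖ₑ ^ (3 : ℕ) ≤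
      ((N : ℝ≥0∞) * ENNReal.ofReal R ^ 2) ^ (3 / 4 : ℝ) * ENNReal.ofReal (R ^ 2) ^ (1 / 4 : ℝ) := by
    have hgm : AEMeasurable (fun s : ℝ => ∫⁻ y in B, ‖U s y‖ₑ ^ (3 : ℕ)) (volume.restrict I) :=
      h3m.lintegral_prod_right'
    have hpq : (4 / 3 : ℝ).HolderConjugate 4 := Real.holderConjugate_iff.2 ⟨by norm_num, by norm_num⟩
    have hH := ENNReal.lintegral_mul_le_Lp_mul_Lq (volume.restrict I) hpq hgm aemeasurable_const
      (g := fun _ => (1 : ℝ≥0∞))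
    simp only [Pi.mul_apply, mul_one, ENNReal.one_rpow, setLIntegral_one] at hH
    calc ∫⁻ z in I ×ˢ B, ‖U z.1 z.2‖ₑ ^ (3 : ℕ)
        ≤ ∫⁻ s in I, ∫⁻ y in B, ‖U s y‖ₑ ^ (3 : ℕ) := by
          rw [hprod]; exact lintegral_prod_le _
      _ ≤ (∫⁻ s in I, (∫⁻ y in B, ‖U s y‖ₑ ^ (3 : ℕ)) ^ (4 / 3 : ℝ)) ^ (1 / (4 / 3) : ℝ) *
            volume I ^ (1 / 4 : ℝ) := hH
      _ ≤ ((N : ℝ≥0∞) * ENNReal.ofReal R ^ 2) ^ (3 / 4 : ℝ) *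
            ENNReal.ofReal (R ^ 2) ^ (1 / 4 : ℝ) := by
          rw [hIvol, show (1 / (4 / 3) : ℝ) = 3 / 4 by norm_num]
          exact mul_le_mul' (ENNReal.rpow_le_rpow hdrift (by norm_num)) le_rfl
  -- ### Hölder `(3, 3/2)` on `W`
  have hpq : (3 : ℝ).HolderConjugate (3 / 2) := Real.holderConjugate_iff.2 ⟨by norm_num, by norm_num⟩
  have hH := ENNReal.lintegral_mul_le_Lp_mul_Lq (volume.restrict W) hpq h1m aemeasurable_const
    (g := fun _ => (1 : ℝ≥0∞))
  simp only [Pi.mul_apply, mul_one, ENNReal.one_rpow, setLIntegral_one] at hH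
  have hW3 : ∫⁻ z in W, ‖U z.1 z.2‖ₑ ^ (3 : ℝ) ≤
      ((N : ℝ≥0∞) * ENNReal.ofReal R ^ 2) ^ (3 / 4 : ℝ) * ENNReal.ofReal (R ^ 2) ^ (1 / 4 : ℝ) := by
    calc ∫⁻ z in W, ‖U z.1 z.2‖ₑ ^ (3 : ℝ) = ∫⁻ z in W, ‖U z.1 z.2‖ₑ ^ (3 : ℕ) := by
          refine lintegral_congr fun z => ?_
          rw [show (3 : ℝ) = ((3 : ℕ) : ℝ) by norm_num, ENNReal.rpow_natCast]
      _ ≤ ∫⁻ z in I ×ˢ B, ‖U z.1 z.2‖ₑ ^ (3 : ℕ) := lintegral_mono_set hW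
      _ ≤ _ := hJ
  calc ∫⁻ z in W, ‖U z.1 z.2‖ₑ
      ≤ (∫⁻ z in W, ‖U z.1 z.2‖ₑ ^ (3 : ℝ)) ^ (1 / 3 : ℝ) * volume W ^ (1 / (3 / 2) : ℝ) := hH
    _ ≤ (((N : ℝ≥0∞) * ENNReal.ofReal R ^ 2) ^ (3 / 4 : ℝ) *
          ENNReal.ofReal (R ^ 2) ^ (1 / 4 : ℝ)) ^ (1 / 3 : ℝ) * volume W ^ (2 / 3 : ℝ) := by
        rw [show (1 / (3 / 2) : ℝ) = 2 / 3 by norm_num]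
        exact mul_le_mul' (ENNReal.rpow_le_rpow hW3 (by norm_num)) le_rfl
    _ = ((N : ℝ≥0∞) * ENNReal.ofReal R ^ 2) ^ (1 / 4 : ℝ) * ENNReal.ofReal (R ^ 2) ^ (1 / 12 : ℝ) *
          volume W ^ (2 / 3 : ℝ) := by
        rw [ENNReal.mul_rpow_of_nonneg _ _ (by norm_num : (0 : ℝ) ≤ 1 / 3), ← ENNReal.rpow_mul,
          ← ENNReal.rpow_mul]
        norm_num

/-- **The axis integral `∫∫ 1/|x'|` over `[a, t₀[ × B̄(0, ρ₁)`**: with the constant `C₁` of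
`lintegral_inv_cylRadius_rpow_ball_le` for `q = 1`,
`∫∫_{[a,t₀[ × B̄(ρ₁)} 1/|x'| ≤ (t₀ - a) · C₁ · (2ρ₁)²` (`B̄(ρ₁) ⊆ B(2ρ₁)`).
[cite: NazarovUraltseva2012, §4, `1/|x'| ∈ L_{9/5,∞}` / `L_{q,∞}`, `q < 2`] -/
theorem lintegral_inv_cylRadius_Ico_closedBall_le {C₁ : ℝ≥0}
    (hC₁ : ∀ (x₀ : EuclideanSpace ℝ (Fin 3)) (r : ℝ), 0 < r →
      ∫⁻ x in ball x₀ r, ENNReal.ofReal (cylRadius x ^ (-(1 : ℝ))) ≤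
        (C₁ : ℝ≥0∞) * ENNReal.ofReal (r ^ (3 - (1 : ℝ))))
    {a t₀ ρ₁ : ℝ} (hρ₁ : 0 < ρ₁) :
    ∫⁻ z in Ico a t₀ ×ˢ closedBall (0 : EuclideanSpace ℝ (Fin 3)) ρ₁,
        ENNReal.ofReal (cylRadius z.2)⁻¹ ≤
      ENNReal.ofReal (t₀ - a) * ((C₁ : ℝ≥0∞) * ENNReal.ofReal ((2 * ρ₁) ^ 2)) := by
  have hmeas : Measurable fun x : EuclideanSpace ℝ (Fin 3) => ENNReal.ofReal (cylRadius x)⁻¹ :=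
    ENNReal.measurable_ofReal.comp continuous_cylRadius.measurable.inv
  have h1 : ∫⁻ z in Ico a t₀ ×ˢ closedBall (0 : EuclideanSpace ℝ (Fin 3)) ρ₁,
      ENNReal.ofReal (cylRadius z.2)⁻¹ =
      volume (Ico a t₀) * ∫⁻ x in closedBall (0 : EuclideanSpace ℝ (Fin 3)) ρ₁,
        ENNReal.ofReal (cylRadius x)⁻¹ := by
    rw [Measure.volume_eq_prod, ← Measure.prod_restrict]
    have h := lintegral_prod_mul (μ := volume.restrict (Ico a t₀))
      (ν := volume.restrict (closedBall (0 : EuclideanSpace ℝ (Fin 3)) ρ₁))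
      (f := fun _ => (1 : ℝ≥0∞)) (g := fun x => ENNReal.ofReal (cylRadius x)⁻¹)
      aemeasurable_const hmeas.aemeasurable
    simp only [one_mul, lintegral_const, Measure.restrict_apply_univ] at h
    exact h
  have h2 : ∫⁻ x in closedBall (0 : EuclideanSpace ℝ (Fin 3)) ρ₁, ENNReal.ofReal (cylRadius x)⁻¹ ≤
      (C₁ : ℝ≥0∞) * ENNReal.ofReal ((2 * ρ₁) ^ 2) := by
    calc ∫⁻ x in closedBall (0 : EuclideanSpace ℝ (Fin 3)) ρ₁, ENNReal.ofReal (cylRadius x)⁻¹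
        ≤ ∫⁻ x in ball (0 : EuclideanSpace ℝ (Fin 3)) (2 * ρ₁), ENNReal.ofReal (cylRadius x)⁻¹ :=
          lintegral_mono_set (closedBall_subset_ball (by linarith))
      _ = ∫⁻ x in ball (0 : EuclideanSpace ℝ (Fin 3)) (2 * ρ₁),
            ENNReal.ofReal (cylRadius x ^ (-(1 : ℝ))) := by
          refine lintegral_congr fun x => ?_
          rw [Real.rpow_neg (cylRadius_nonneg x), Real.rpow_one]
      _ ≤ (C₁ : ℝ≥0∞) * ENNReal.ofReal ((2 * ρ₁) ^ (3 - (1 : ℝ))) := hC₁ 0 (2 * ρ₁) (by linarith)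
      _ = (C₁ : ℝ≥0∞) * ENNReal.ofReal ((2 * ρ₁) ^ 2) := by
          rw [show (3 : ℝ) - 1 = ((2 : ℕ) : ℝ) by norm_num, Real.rpow_natCast]
  rw [h1, Real.volume_Ico]
  exact mul_le_mul' le_rfl h2

end Summit.NavierStokesRegularity.NavierStokesRegularity.Theorems.AxisymmetricKatoGlobal.EulerScaling

end
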